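import Mathlib

/-!
# Calibration of the identification adversary: binary search solves the KW game of a linear form

Support theorem for the crux `stmt-ValiantsHypothesis-10298` (`…Theses.AlgebraicKWGames.KWPerLowerBound`),
filed `--supports`; the crux is NOT proved — this file records, in the kernel, why the adversary of
`…AlgebraicKWGamesHistoryAlternation*` (and of items 10302/10299) cannot prove it.

That adversary uses the searched polynomial `f` only through its dependence on every cell
(`kwSearch_lowerBound_of_altBound` quantifies over all such `f`).  The linear form `ℓ = Σ_e x_e` depends
on every cell, and its KW game — on `ℓ(a) ≠ ℓ(b)` find a cell with `a_e ≠ b_e` — is solved in the model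
of the crux by BINARY SEARCH in `2L` rounds whenever `n² ≤ 2^L` (`kwSearch_linearForm_upper`): on a
dyadic interval `S = S₁ ⊔ S₂` of cells with `Φ(S) = Σ_{e ∈ S} (a_e − b_e) ≠ 0`, Alice announces
`Σ_{e ∈ S₁} a_e`, Bob announces `Σ_{e ∈ S₁} a_e − Σ_{e ∈ S₁} b_e = Φ(S₁)`, and the public zero bit sends
the search to `S₁` (if `Φ(S₁) ≠ 0`) or to `S₂` (then `Φ(S₂) = Φ(S) − Φ(S₁) ≠ 0`: additivity forbids a
simultaneous false zero).  Hence no argument that is blind to `f` beyond "depends on every cell" can show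
a depth lower bound above `2⌈log₂ n²⌉` for protocols with `≈ 4 log₂ n` alternations; combined with the
lower bound `(2T+1)^(Δ+2) + 1 ≤ n² ⇒ impossible with Δ alternations` this pins down what the engine
measures (alternations), and that `KWPerLowerBound` needs an adversary that sees the permanent.

Honest framing: toy communication model, dormant route; nothing here bears on VP versus VNP.
-/

-- the summit and the problem share the name `ValiantsHypothesis` (D-0017 single-conjunct layout)
set_option linter.dupNamespace false

namespace Summit.ValiantsHypothesis.ValiantsHypothesis.Theorems.AlgebraicKWGames

open MvPolynomial

namespace LinSearch

variable {n : ℕ}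

/-- The left end of the dyadic search interval after `k` levels, read off a zero pattern `z`: level `i`
moves right (by `2^(L-1-i)`) iff the zero bit of round `2i+1` (Bob's test of the left half) is set. -/
def loEnd (L : ℕ) (z : ℕ → Bool) (k : ℕ) : ℕ :=
  ∑ i ∈ Finset.range k, if z (2 * i + 1) then 2 ^ (L - 1 - i) else 0

/-- One more level. -/
theorem loEnd_succ (L : ℕ) (z : ℕ → Bool) (k : ℕ) :
    loEnd L z (k + 1) = loEnd L z k + (if z (2 * k + 1) then 2 ^ (L - 1 - k) else 0) := by
  simp [loEnd, Finset.sum_range_succ]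

/-- `loEnd` depends only on the zero bits of the rounds `< 2k`. -/
theorem loEnd_congr (L : ℕ) {z z' : ℕ → Bool} {k : ℕ} (h : ∀ j < 2 * k, z j = z' j) :
    loEnd L z k = loEnd L z' k := by
  unfold loEnd
  refine Finset.sum_congr rfl fun i hi => ?_
  have hi' : i < k := Finset.mem_range.mp hi
  rw [h (2 * i + 1) (by omega)]

/-- The cells whose index lies in `[c, c + w)`. -/
def cellsIn (c w : ℕ) : Finset (Fin n × Fin n) :=
  Finset.univ.filter fun e => c ≤ (finProdFinEquiv e : ℕ) ∧ (finProdFinEquiv e : ℕ) < c + w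

/-- Splitting an interval of cells. -/
theorem cellsIn_split (c w w' : ℕ) :
    (cellsIn c (w + w') : Finset (Fin n × Fin n)) = cellsIn c w ∪ cellsIn (c + w) w' := by
  ext e
  simp only [cellsIn, Finset.mem_filter, Finset.mem_univ, true_and, Finset.mem_union]
  omega

/-- The two halves are disjoint. -/
theorem cellsIn_disjoint (c w w' : ℕ) :
    Disjoint (cellsIn c w : Finset (Fin n × Fin n)) (cellsIn (c + w) w') := by
  rw [Finset.disjoint_left]
  intro e h1 h2
  simp only [cellsIn, Finset.mem_filter, Finset.mem_univ, true_and] at h1 h2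
  omega

/-- All cells lie in `[0, 2^L)` when `n² ≤ 2^L`. -/
theorem cellsIn_zero_eq_univ {L : ℕ} (hL : n * n ≤ 2 ^ L) :
    (cellsIn 0 (2 ^ L) : Finset (Fin n × Fin n)) = Finset.univ := by
  ext e
  simp only [cellsIn, Finset.mem_filter, Finset.mem_univ, true_and, zero_le, zero_add, iff_true]
  exact lt_of_lt_of_le (finProdFinEquiv e).2 hL

/-- A width-one interval of cells with nonzero mass is the singleton of the cell with that index. -/
theorem mem_cellsIn_one {c : ℕ} {e : Fin n × Fin n} :
    e ∈ (cellsIn c 1 : Finset (Fin n × Fin n)) ↔ (finProdFinEquiv e : ℕ) = c := by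
  simp only [cellsIn, Finset.mem_filter, Finset.mem_univ, true_and]
  omega

/-- The mass `Φ(S) = Σ_{e ∈ S} (a_e - b_e)` of a set of cells. -/
def mass (a b : Fin n × Fin n → ℂ) (S : Finset (Fin n × Fin n)) : ℂ := ∑ e ∈ S, (a e - b e)

/-- The protocol's schedule: Alice speaks in the even rounds, Bob in the odd ones. -/
def owner (t : ℕ) (_z : Fin t → Bool) : Bool := decide (Even t)

/-- Extend a finite zero pattern by `false` (only the available bits are ever read). -/
def ext {t : ℕ} (z : Fin t → Bool) : ℕ → Bool := fun j => if h : j < t then z ⟨j, h⟩ else false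

/-- The left half searched in round `t = 2k` or `2k+1`: cells with index in
`[loEnd k, loEnd k + 2^(L-1-k))`. -/
def leftHalf (L : ℕ) {t : ℕ} (z : Fin t → Bool) : Finset (Fin n × Fin n) :=
  cellsIn (loEnd L (ext z) (t / 2)) (2 ^ (L - 1 - t / 2))

/-- The messages: in round `2k` Alice announces the sum of her entries over the left half; in round
`2k+1` Bob announces Alice's last message minus the sum of his entries over the same half. -/
noncomputable def msg (L : ℕ) (t : ℕ) (z : Fin t → Bool) : MvPolynomial ((Fin n × Fin n) ⊕ Fin t) ℂ :=
  if Even t then ∑ e ∈ leftHalf (n := n) L z, X (Sum.inl e)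
  else (if h : 0 < t then X (Sum.inr ⟨t - 1, by omega⟩) else 0) - ∑ e ∈ leftHalf (n := n) L z, X (Sum.inl e)

/-- The output: the cell whose index is the left end of the final interval (a default cell if that
index is out of range, which correctness shows never happens). -/
noncomputable def out (L : ℕ) (hn : 0 < n * n) (z : Fin (2 * L) → Bool) : Fin n × Fin n :=
  if h : loEnd L (ext z) L < n * n then finProdFinEquiv.symm ⟨loEnd L (ext z) L, h⟩
  else finProdFinEquiv.symm ⟨0, hn⟩

/-- The alternating schedule flips the speaker at every round: along every zero pattern it has exactly
`2L - 1` alternations in `2L` rounds (so the lower bound `kwSearch_lowerBound_of_altBound`, which needs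
`(2T+1)^(Δ+2) + 1 ≤ n²`, says nothing about it). -/
theorem card_alternations_owner (L : ℕ) (z : ℕ → Bool) :
    ((Finset.range (2 * L - 1)).filter (fun s =>
      owner s (fun j : Fin s => z j) ≠ owner (s + 1) (fun j : Fin (s + 1) => z j))).card = 2 * L - 1 := by
  rw [Finset.filter_true_of_mem, Finset.card_range]
  intro s _
  simp only [owner, ne_eq, decide_eq_decide, Nat.even_add_one]
  exact iff_not_self

end LinSearch

open LinSearch in
/-- **Binary search solves the KW game of a linear form in `2⌈log₂ n²⌉` rounds.**  For `1 ≤ n` and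
`n² ≤ 2^L` there is a zero-test algebraic protocol of depth `2L` in the model of the crux
`KWPerLowerBound` (speaker read off the zero pattern — here simply alternating, with exactly `2L - 1`
alternations along every zero pattern —, polynomial messages in the speaker's input and the earlier messages, output cell read
off the zero pattern) that solves the KW game of `ℓ = Σ_e x_e`: whenever `Σ_e a_e ≠ Σ_e b_e`, the output
cell `e` has `a_e ≠ b_e`.  Since `ℓ` depends on every cell, this is the upper bound matching the
function-oblivious lower bound `kwSearch_lowerBound_of_altBound` up to what alternation buys. -/
theorem kwSearch_linearForm_upper (n L : ℕ) (hn : 1 ≤ n) (hL : n * n ≤ 2 ^ L) :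
    ∃ (owner : (t : ℕ) → (Fin t → Bool) → Bool)
      (msg : (t : ℕ) → (Fin t → Bool) → MvPolynomial ((Fin n × Fin n) ⊕ Fin t) ℂ)
      (out : (Fin (2 * L) → Bool) → Fin n × Fin n),
      (∀ z : ℕ → Bool, ((Finset.range (2 * L - 1)).filter (fun s =>
        owner s (fun j : Fin s => z j) ≠ owner (s + 1) (fun j : Fin (s + 1) => z j))).card = 2 * L - 1) ∧
      ∀ a b : (Fin n × Fin n) → ℂ,
        eval a (∑ e : Fin n × Fin n, X e) ≠ eval b (∑ e : Fin n × Fin n, X e) →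
        ∀ (m : ℕ → ℂ) (z : ℕ → Bool), (∀ j, z j = true ↔ m j = 0) →
          (∀ t < 2 * L, m t = eval (Sum.elim (if owner t (fun j : Fin t => z j) then a else b)
            (fun j : Fin t => m j)) (msg t (fun j : Fin t => z j))) →
          a (out (fun j : Fin (2 * L) => z j)) ≠ b (out (fun j : Fin (2 * L) => z j)) := by
  have hn2 : 0 < n * n := Nat.mul_pos hn hn
  refine ⟨LinSearch.owner, LinSearch.msg L, LinSearch.out L hn2, card_alternations_owner L, ?_⟩
  intro a b hab m z hz hm
  -- `ext` of a restriction of `z` agrees with `z` on the available bits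
  have hext : ∀ (t j : ℕ), j < t → LinSearch.ext (fun j : Fin t => z j) j = z j := by
    intro t j hj; simp [LinSearch.ext, hj]
  have hlo : ∀ t k : ℕ, 2 * k ≤ t → loEnd L (LinSearch.ext (fun j : Fin t => z j)) k = loEnd L z k := by
    intro t k hk
    exact loEnd_congr L (fun j hj => hext t j (by omega))
  -- the invariant: the current dyadic interval has nonzero mass
  have key : ∀ k ≤ L, mass a b (cellsIn (loEnd L z k) (2 ^ (L - k))) ≠ 0 := by
    intro k
    induction k with
    | zero =>
      intro _
      have h0 : loEnd L z 0 = 0 := by simp [loEnd]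
      rw [h0, Nat.sub_zero, cellsIn_zero_eq_univ hL, mass]
      simpa [MvPolynomial.eval_sum, Finset.sum_sub_distrib, sub_ne_zero] using hab
    | succ k ih =>
      intro hk
      have hk' : k < L := hk
      have ihk := ih hk'.le
      -- the two halves
      set w := 2 ^ (L - 1 - k) with hw
      have hsplit : (cellsIn (loEnd L z k) (2 ^ (L - k)) : Finset (Fin n × Fin n)) =
          cellsIn (loEnd L z k) w ∪ cellsIn (loEnd L z k + w) w := by
        rw [← cellsIn_split]
        congr 1
        rw [hw, ← two_mul, ← pow_succ']
        congr 1; omega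
      have hmass : mass a b (cellsIn (loEnd L z k) (2 ^ (L - k))) =
          mass a b (cellsIn (loEnd L z k) w) + mass a b (cellsIn (loEnd L z k + w) w) := by
        rw [hsplit, mass, Finset.sum_union (cellsIn_disjoint _ _ _)]; rfl
      -- the two messages of level `k`
      have hA := hm (2 * k) (by omega)
      have hB := hm (2 * k + 1) (by omega)
      have hleftA : (leftHalf L (fun j : Fin (2 * k) => z j) : Finset (Fin n × Fin n)) =
          cellsIn (loEnd L z k) w := by
        simp only [leftHalf, hw]
        rw [show 2 * k / 2 = k by omega, hlo (2 * k) k le_rfl]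
      have hleftB : (leftHalf L (fun j : Fin (2 * k + 1) => z j) : Finset (Fin n × Fin n)) =
          cellsIn (loEnd L z k) w := by
        simp only [leftHalf, hw]
        rw [show (2 * k + 1) / 2 = k by omega, hlo (2 * k + 1) k (by omega)]
      have hevenA : Even (2 * k) := even_two_mul k
      have hoddB : ¬ Even (2 * k + 1) := Nat.not_even_two_mul_add_one k
      have hmsgA : LinSearch.msg (n := n) L (2 * k) (fun j : Fin (2 * k) => z j) =
          ∑ e ∈ cellsIn (loEnd L z k) w, X (Sum.inl e) := by
        simp only [LinSearch.msg, if_pos hevenA, hleftA]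
      have hownA : LinSearch.owner (2 * k) (fun j : Fin (2 * k) => z j) = true := by
        simp [LinSearch.owner, hevenA]
      have hmA : m (2 * k) = ∑ e ∈ cellsIn (loEnd L z k) w, a e := by
        rw [hA, hmsgA, hownA, map_sum]
        refine Finset.sum_congr rfl fun e _ => ?_
        simp
      have hmsgB : LinSearch.msg (n := n) L (2 * k + 1) (fun j : Fin (2 * k + 1) => z j) =
          X (Sum.inr ⟨2 * k + 1 - 1, by omega⟩) - ∑ e ∈ cellsIn (loEnd L z k) w, X (Sum.inl e) := by
        simp only [LinSearch.msg, if_neg hoddB, hleftB, dif_pos (Nat.succ_pos (2 * k))]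
      have hownB : LinSearch.owner (2 * k + 1) (fun j : Fin (2 * k + 1) => z j) = false := by
        simp [LinSearch.owner, hoddB]
      have hmB : m (2 * k + 1) = mass a b (cellsIn (loEnd L z k) w) := by
        rw [hB, hmsgB, hownB, map_sub, map_sum, mass, Finset.sum_sub_distrib]
        congr 1
        · have h1 : (eval (Sum.elim (if false = true then a else b) fun j : Fin (2 * k + 1) => m ↑j))
              (X (Sum.inr ⟨2 * k + 1 - 1, by omega⟩)) = m (2 * k) := by
            rw [eval_X]; simp
          rw [h1, hmA]
        · refine Finset.sum_congr rfl fun e _ => ?_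
          simp
      -- branch on Bob's zero bit
      rw [loEnd_succ]
      by_cases hzb : z (2 * k + 1) = true
      · -- false zero impossible: the right half carries the mass
        rw [if_pos hzb]
        have h0 : mass a b (cellsIn (loEnd L z k) w) = 0 := by rw [← hmB]; exact (hz _).mp hzb
        have : L - (k + 1) = L - 1 - k := by omega
        rw [this, ← hw]
        intro hzero
        apply ihk
        rw [hmass, h0, hzero, add_zero]
      · rw [if_neg hzb, add_zero]
        have h0 : mass a b (cellsIn (loEnd L z k) w) ≠ 0 := by
          rw [← hmB]; intro h; exact hzb ((hz _).mpr h)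
        have : L - (k + 1) = L - 1 - k := by omega
        rwa [this, ← hw]
  -- at level `L` the interval is a single index, which must be a cell where `a ≠ b`
  have hL' := key L le_rfl
  rw [Nat.sub_self, pow_zero] at hL'
  obtain ⟨e, he, hne⟩ := Finset.exists_ne_zero_of_sum_ne_zero hL'
  rw [mem_cellsIn_one] at he
  have hidx : loEnd L z L < n * n := by rw [← he]; exact (finProdFinEquiv e).2
  have hout : LinSearch.out L hn2 (fun j : Fin (2 * L) => z j) = e := by
    unfold LinSearch.out
    rw [hlo (2 * L) L le_rfl, dif_pos hidx]
    apply finProdFinEquiv.injective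
    rw [Equiv.apply_symm_apply]
    exact Fin.ext he.symm
  rw [hout]
  exact sub_ne_zero.mp hne

/-- The linear form `Σ_e x_e` depends on every cell (pointwise): at the origin, setting any entry to `1`
changes it. -/
theorem linearForm_depends_on_every_cell (n : ℕ) (e₀ : Fin n × Fin n) :
    ∃ a : Fin n × Fin n → ℂ, ∃ w : ℂ,
      eval a (∑ e : Fin n × Fin n, X e) ≠ eval (Function.update a e₀ w) (∑ e : Fin n × Fin n, X e) := by
  refine ⟨fun _ => 0, 1, ?_⟩
  rw [MvPolynomial.eval_sum, MvPolynomial.eval_sum]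
  simp only [eval_X, Finset.sum_const_zero]
  rw [Finset.sum_eq_single e₀ (fun e _ he => by simp [Function.update_of_ne he]) (by simp)]
  simp

/-- **The function-oblivious barrier, in one statement.**  For `1 ≤ n` and `n² ≤ 2^L` there is a
polynomial in the `n × n` cells that depends on every cell — the only property of `per_n` that the
adversary of `…AlgebraicKWGamesHistoryAlternation*` (items 10302/10299 and the history-dependent rung)
ever uses, cf. the hypothesis of `kwSearch_lowerBound_of_altBound` — whose KW game IS solved by a
protocol of depth `2L` (with `2L - 1` alternations) in the model of `KWPerLowerBound`.  Hence no
argument about protocols that sees the searched polynomial only through "depends on every cell" can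
prove `KWPerLowerBound` (depth `c·(⌊log₂ n⌋+1)² ≥ 2⌈log₂ n²⌉` once `c ≥ 5`); what such arguments bound
is the number of alternations. -/
theorem exists_dependsOnEveryCell_solved_in_log_depth (n L : ℕ) (hn : 1 ≤ n) (hL : n * n ≤ 2 ^ L) :
    ∃ f : MvPolynomial (Fin n × Fin n) ℂ,
      (∀ e₀ : Fin n × Fin n, ∃ a : Fin n × Fin n → ℂ, ∃ w : ℂ,
        eval a f ≠ eval (Function.update a e₀ w) f) ∧
      ∃ (owner : (t : ℕ) → (Fin t → Bool) → Bool)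
        (msg : (t : ℕ) → (Fin t → Bool) → MvPolynomial ((Fin n × Fin n) ⊕ Fin t) ℂ)
        (out : (Fin (2 * L) → Bool) → Fin n × Fin n),
        (∀ z : ℕ → Bool, ((Finset.range (2 * L - 1)).filter (fun s =>
          owner s (fun j : Fin s => z j) ≠ owner (s + 1) (fun j : Fin (s + 1) => z j))).card = 2 * L - 1) ∧
        ∀ a b : (Fin n × Fin n) → ℂ, eval a f ≠ eval b f →
          ∀ (m : ℕ → ℂ) (z : ℕ → Bool), (∀ j, z j = true ↔ m j = 0) →
            (∀ t < 2 * L, m t = eval (Sum.elim (if owner t (fun j : Fin t => z j) then a else b)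
              (fun j : Fin t => m j)) (msg t (fun j : Fin t => z j))) →
            a (out (fun j : Fin (2 * L) => z j)) ≠ b (out (fun j : Fin (2 * L) => z j)) :=
  ⟨∑ e : Fin n × Fin n, X e, linearForm_depends_on_every_cell n, kwSearch_linearForm_upper n L hn hL⟩

end Summit.ValiantsHypothesis.ValiantsHypothesis.Theorems.AlgebraicKWGames
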